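import Summits.QuantumFields.BalabanUV.T4Continuum.Support.NE3EnergyHessBilin
import Summits.QuantumFields.BalabanUV.T4Continuum.Support.NE3HessContinuity
import Summits.QuantumFields.BalabanUV.T4Continuum.Support.NE3TangentFlatPush
import Summits.QuantumFields.BalabanUV.T4Continuum.Support.NE3FlatHessianCurl
import HarnessLib

/-!
# NE7CubicVertexLetters — the commutator part `𝒬(A) := dcurlAt flat A A` of the non-abelian curvature at the trivial flat datum: translation
# covariance, size `≤ 32α₀²`, and ADJACENT DIFFERENCES `≤ 64·α₀·α₁` in the GRADIENT currency — the one new lattice estimate of memo H14 §7's plan for the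
# strong expansion remainder (EXP) of F38's bundle

Cell `pub-balaban`, rung (B)+1 sub-cell t4, lineage `b2b-balaban-t4-ne7-p1`, generation 70 (CRUX PROVER NE7 #1); memo
`t4/b2b-balaban-t4-ne7-p1-g70/HUNT-H14-APE-FLAT-SKELETON.md` §7.  File F46 (over row NE3's `NE3HessContinuity.norm_dcurlAt_le` (`‖dcurlAt V X Y‖ ≤ 2·bl₁(X)·bl₁(Y)`),
`NE3EnergyHessBilin.dcurlAt_add_left ∕ _right`, `NE3FlatHessianCurl.isUnitaryCfg_flatCfg`).
WHY.  In the strong expansion remainder (memo §7) the only term beyond the reach of the tree's Lipschitz letters with the a-priori curl bound is the cubic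
vertex `Σ_p Re tr[(d_{flat}Y)(p)·(d_sA − d_0A)(p)]`, and `d_sA − d_0A = s·𝒬(A) + O(α₀³)` with `𝒬(A)(p′) = dcurlAt flat A A p′` (the `s`-derivative of
`s ↦ d_{e^{sA}}A` at `0`, `hasDerivAt_curlAt_vary`: the sum of commutators `[A_b, A_{b′}]` over the bonds of `∂p′` = the quadratic part of the non-abelian
curvature).  Paired directly with `‖d Y‖ ≤ bl₁(Y)` it has density `32α₀² = 32α̂²M⁻²` — ONE POWER OF `M` SHORT; moved onto `Y` by the tree's summation by
parts (`NE7TensionPairing.sum_antisym_pairing_eq_tension_pairing`) it costs the ADJACENT DIFFERENCES of `𝒬(A)`, which THIS FILE bounds by `64α₀α₁` —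
`α₁` the sup of the lattice differences of `A` (the gradient currency `α̂₁M⁻²` of B8 (1.36) ∕ B11 (152)): density `64α̂α̂₁M⁻³`, what the slice solver tolerates.
WHAT ([folklore]; 0 def, 0 sorry).  §1 `isUnitaryCfg_flat`, `dcurlAt_flat_shift` (translating both fields translates the plaquette).  §2 `bondL1At_le_of_sup`.
§3 `norm_dcurlAt_flat_self_le` (`‖𝒬(A)(p′)‖ ≤ 32α₀²`), **`norm_dcurlAt_flat_self_sub_shift_le`** (`‖𝒬(A)(z) − 𝒬(A)(z − e_τ)‖ ≤ 64α₀α₁`: bilinearity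
`𝒬(A) − 𝒬(A′) = dcurlAt D A + dcurlAt A′ D`, `A′ = A(· − e_τ)`, `D = A − A′`).
HONEST FRAMING (page 1): lattice algebra; the by-parts assembly and the `O(α₀³)` tail of `d_sA − d_0A − s𝒬(A)` are NOT here; nothing of Bałaban's
asserted; NOT (APE), NOT ONE-STEP, NOT NE7; spine 0∕9; finite T⁴ rung (B)+1 — NOT infinite volume, NOT mass gap, NOT Clay.  Continuum YM on T⁴ ⇐ BetaPertH ∧
nine spine estimates (0/9 proved); BetaPertH ⇐ (D1) ∧ (D4) ∧ CAP+tail; G-an2-4 gates asym, D1 and NE2/3/4.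
-/

set_option autoImplicit false

open scoped BigOperators Matrix.Norms.L2Operator
open NormedSpace Finset Set

namespace Summit.QuantumFields.BalabanUV.T4Continuum.NE7CubicVertexLetters

open Literature.MathematicalPhysics.QuantumFieldTheory.Balaban1983to89
open B7Prop1Explicit B7Prop2Explicit MatrixLog UnitaryModel
open T4AveragingDeficitWall (IsUnitaryCfg IsSkewDir Ad)
open NE3HessForm (dcurlAt)
open NE3HessContinuity (bondL1At norm_dcurlAt_le)
open NE3EnergyHessBilin (dcurlAt_add_left dcurlAt_add_right dcurlAt_smul_left dcurlAt_smul_right)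
open BlockAveragePushDirSplit (flat)
open NE3TangentFlatPush (flatCfg_eq_flat)

noncomputable section

variable {d : ℕ} {n : Type*} [Fintype n] [DecidableEq n]

/-! ## §1 The flat background; translation covariance of `dcurlAt` there -/

/-- The flat background is unitary (`flat = flatCfg`, row NE3's `isUnitaryCfg_flatCfg`). [folklore] -/
theorem isUnitaryCfg_flat : IsUnitaryCfg (flat (d := d) (n := n)) := by
  rw [← flatCfg_eq_flat]
  exact NE3FlatHessianCurl.isUnitaryCfg_flatCfg



/-- At the flat background `dcurlAt` only sees the direction fields on the bonds of the plaquette: translating both fields by `t` translates the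
plaquette. [folklore] -/
theorem dcurlAt_flat_shift (X Y : Site d → Fin d → Matrix n n ℂ) (t z : Site d) (μ ν : Fin d) :
    dcurlAt (flat (d := d) (n := n)) (fun y κ => X (y - t) κ) (fun y κ => Y (y - t) κ) z μ ν
      = dcurlAt (flat (d := d) (n := n)) X Y (z - t) μ ν := by
  simp only [dcurlAt, BlockAveragePushDirSplit.flat, add_sub_right_comm]

/-! ## §2 The four-bond sums of a bounded field and of a lattice difference -/

/-- `bondL1At X p′ ≤ 4·sup‖X‖`. [folklore] -/
theorem bondL1At_le_of_sup {X : Site d → Fin d → Matrix n n ℂ} {s : ℝ} (hX : ∀ y κ, ‖X y κ‖ ≤ s) (z : Site d) (μ ν : Fin d) :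
    bondL1At X z μ ν ≤ 4 * s := by
  unfold bondL1At
  linarith [hX z μ, hX (z + e μ) ν, hX (z + e ν) μ, hX z ν]

/-! ## §3 The size and the adjacent differences of `𝒬(A) = dcurlAt flat A A` -/

/-- **SIZE**: `‖𝒬(A)(p′)‖ ≤ 32α₀²` for `‖A‖ ≤ α₀` (`norm_dcurlAt_le`: `≤ 2·bondL1At·bondL1At`). [folklore] -/
theorem norm_dcurlAt_flat_self_le {A : Site d → Fin d → Matrix n n ℂ} {α₀ : ℝ}
    (hA : ∀ y κ, ‖A y κ‖ ≤ α₀) (z : Site d) (μ ν : Fin d) :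
    ‖dcurlAt (flat (d := d) (n := n)) A A z μ ν‖ ≤ 32 * α₀ ^ 2 := by
  have hα : 0 ≤ α₀ := (norm_nonneg _).trans (hA z μ)
  have h := norm_dcurlAt_le (isUnitaryCfg_flat (d := d) (n := n)) A A z μ ν
  have hb : bondL1At A z μ ν ≤ 4 * α₀ := bondL1At_le_of_sup hA z μ ν
  have hb0 : 0 ≤ bondL1At A z μ ν := by unfold bondL1At; positivity
  have hsq : bondL1At A z μ ν * bondL1At A z μ ν ≤ (4 * α₀) * (4 * α₀) := mul_le_mul hb hb hb0 (by positivity)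
  nlinarith

/-- **ADJACENT DIFFERENCES IN THE GRADIENT CURRENCY** — the one new estimate of the strong expansion remainder (memo H14 §7): if `‖A‖ ≤ α₀` and
every lattice difference of `A` is `≤ α₁` (`‖A(y + e_τ, κ) − A(y, κ)‖ ≤ α₁` for all bonds `(y,κ)` and directions `τ`), then for every plaquette and
direction `‖𝒬(A)(z) − 𝒬(A)(z − e_τ)‖ ≤ 64·α₀·α₁` — bilinearity of `dcurlAt` + §1 + `norm_dcurlAt_le`; in the currencies `α₀ = α̂M⁻¹`, `α₁ = α̂₁M⁻²`
this is `64α̂α̂₁·M⁻³`, the density the slice solver tolerates. [folklore] -/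
theorem norm_dcurlAt_flat_self_sub_shift_le {A : Site d → Fin d → Matrix n n ℂ} {α₀ α₁ : ℝ}
    (hA : ∀ y κ, ‖A y κ‖ ≤ α₀) (hA1 : ∀ (y : Site d) (κ τ : Fin d), ‖A (y + e τ) κ - A y κ‖ ≤ α₁) (z : Site d) (μ ν τ : Fin d) :
    ‖dcurlAt (flat (d := d) (n := n)) A A z μ ν - dcurlAt (flat (d := d) (n := n)) A A (z - e τ) μ ν‖ ≤ 64 * α₀ * α₁ := by
  have hα : 0 ≤ α₀ := (norm_nonneg _).trans (hA z μ)
  have hα1 : 0 ≤ α₁ := (norm_nonneg _).trans (hA1 z μ τ)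
  -- the shifted field and the lattice difference
  set A' : Site d → Fin d → Matrix n n ℂ := fun y κ => A (y - e τ) κ with hA'
  set D : Site d → Fin d → Matrix n n ℂ := fun y κ => A y κ - A (y - e τ) κ with hD
  have hA's : ∀ y κ, ‖A' y κ‖ ≤ α₀ := fun y κ => hA _ _
  have hDs : ∀ y κ, ‖D y κ‖ ≤ α₁ := fun y κ => by
    have h := hA1 (y - e τ) κ τ
    rwa [sub_add_cancel] at h
  -- translation: `𝒬(A)(z − e_τ) = dcurlAt flat A' A' z`
  rw [← dcurlAt_flat_shift A A (e τ) z μ ν]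
  -- bilinearity: `dcurlAt A A − dcurlAt A' A' = dcurlAt D A + dcurlAt A' D`
  have hAD : A = A' + D := by funext y κ; simp [hA', hD]
  have hsplit : dcurlAt (flat (d := d) (n := n)) A A z μ ν - dcurlAt (flat (d := d) (n := n)) A' A' z μ ν
      = dcurlAt (flat (d := d) (n := n)) D A z μ ν + dcurlAt (flat (d := d) (n := n)) A' D z μ ν := by
    have e1 : dcurlAt (flat (d := d) (n := n)) A A z μ ν
        = dcurlAt (flat (d := d) (n := n)) A' A z μ ν + dcurlAt (flat (d := d) (n := n)) D A z μ ν := by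
      conv_lhs => rw [hAD]
      rw [dcurlAt_add_left, ← hAD]
    have e2 : dcurlAt (flat (d := d) (n := n)) A' A z μ ν
        = dcurlAt (flat (d := d) (n := n)) A' A' z μ ν + dcurlAt (flat (d := d) (n := n)) A' D z μ ν := by
      conv_lhs => rw [hAD]
      rw [dcurlAt_add_right]
    rw [e1, e2]
    abel
  rw [show (fun y κ => A (y - e τ) κ) = A' from rfl, hsplit]
  have h1 := norm_dcurlAt_le (isUnitaryCfg_flat (d := d) (n := n)) D A z μ ν
  have h2 := norm_dcurlAt_le (isUnitaryCfg_flat (d := d) (n := n)) A' D z μ ν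
  have hbD := bondL1At_le_of_sup hDs z μ ν
  have hbA := bondL1At_le_of_sup hA z μ ν
  have hbA' := bondL1At_le_of_sup hA's z μ ν
  have hbD0 : 0 ≤ bondL1At D z μ ν := by unfold bondL1At; positivity
  have hbA0 : 0 ≤ bondL1At A z μ ν := by unfold bondL1At; positivity
  have hbA'0 : 0 ≤ bondL1At A' z μ ν := by unfold bondL1At; positivity
  calc ‖dcurlAt (flat (d := d) (n := n)) D A z μ ν + dcurlAt (flat (d := d) (n := n)) A' D z μ ν‖
      ≤ ‖dcurlAt (flat (d := d) (n := n)) D A z μ ν‖ + ‖dcurlAt (flat (d := d) (n := n)) A' D z μ ν‖ := norm_add_le _ _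
    _ ≤ 2 * (bondL1At D z μ ν * bondL1At A z μ ν) + 2 * (bondL1At A' z μ ν * bondL1At D z μ ν) := add_le_add h1 h2
    _ ≤ 2 * ((4 * α₁) * (4 * α₀)) + 2 * ((4 * α₀) * (4 * α₁)) := by
        nlinarith [mul_le_mul hbD hbA hbA0 (by positivity), mul_le_mul hbA' hbD hbD0 (by positivity)]
    _ = 64 * α₀ * α₁ := by ring

end

end Summit.QuantumFields.BalabanUV.T4Continuum.NE7CubicVertexLetters
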